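import Summits.NavierStokesRegularity.NavierStokesRegularity.Theorems.LerayQuarterDissipationRecurrentReductionDKernel
import Literature.Analysis.FluidPDE.TypeIAncientMild
import HarnessLib

/-!
# Route `LerayQuarterDissipation`, item `RecurrentReductionD` (stmt-NavierStokesRegularity-22507):
# sup-norm ε-regularity for `𝒟`, Stage 1 — the core Duhamel estimate on a parabolic region

Helper file (theorems only, `--supports` the item). Stage 1 of the persistence argument for the
finite-dissipation stratum propagates Type-I SMALLNESS from one slice into the parabolic region
`Ω₀ = {(τ, y) : t₁ < τ < 0, ‖y‖ < R + M√(−τ)}`. The engine (`duhamel_le_of_goodBefore`) bounds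
the Duhamel term at `(t, x) ∈ Ω₀` for a Type-I ancient mild field `v` (constant `C`), given
`‖v‖ ≤ a + η(−τ)^{−1/2}` on `Ω₀ ∩ {τ < t⋆}`, `t⋆ ∈ (t₁, t]`, by
`4κ₁a²√(t−t₁) + 2κ₁(C²/(−t))√(t−t⋆) + (8κ₁η² + 2κ₁C²√θ + 8κ₂C²θ^{−1/4}/M)(−t)^{−1/2}`
(`κ₁ = C₀I₂`, `κ₂ = 3C₀|B₁|`): good region, crude layer `[t⋆,t)`, exterior at recent times
`τ > (1+θ)t` (kernel mass) and at old times (parabolic separation + kernel tail). Only the Type-I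
bound is used off the region, so Stage 1 yields Type-I smallness, not boundedness.

References: G. Koch, N. Nadirashvili, G. Seregin, V. Šverák, arXiv:0709.3599, §3 (3.8), §4
[KochNadirashviliSereginSverak2009].
-/

noncomputable section

-- the summit and its single problem share the name (D-0017 nested layout)
set_option linter.dupNamespace false

namespace Summit.NavierStokesRegularity.NavierStokesRegularity.Theorems.RecurrentReductionD

open MeasureTheory Set Function Filter Topology Metric
open Literature.Analysis Literature.Analysis.FluidPDE
open scoped ENNReal NNReal

/-- **The core Duhamel estimate of Stage 1** (see the module docstring for the four terms).
Hypotheses: the Koch–Tataru kernel bound with constant `C₀`; `v` a Type-I ancient mild field with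
constant `C`; times `t₁ < t⋆ ≤ t < 0`; the good bound `‖v(τ,y)‖ ≤ a + η(−τ)^{−1/2}` for
`τ ∈ (t₁, t⋆)`, `‖y‖ < R + M√(−τ)`; a point `x` with `‖x‖ < R + M√(−t)`; a splitting parameter
`θ > 0`. [cite: KochNadirashviliSereginSverak2009, §3 (3.8) and §4 p. 8 (arXiv:0709.3599)] -/
theorem duhamel_le_of_goodBefore {C₀ : ℝ} (hC₀ : 0 < C₀)
    (hK : ∀ ⦃σ : ℝ⦄, 0 < σ → ∀ z a b : EuclideanSpace ℝ (Fin 3),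
      ‖oseenKernel σ z a b‖ ≤ C₀ * (σ + ‖z‖ ^ 2) ^ (-(2 : ℝ)) * ‖a‖ * ‖b‖)
    {C : ℝ} {v : ℝ → EuclideanSpace ℝ (Fin 3) → EuclideanSpace ℝ (Fin 3)}
    (hv : IsTypeIAncientMild C v)
    {t₁ tstar t R M a η θ : ℝ} (h1s : t₁ < tstar) (hst : tstar ≤ t) (ht : t < 0)
    (hM : 0 < M) (hη : 0 ≤ η) (hθ : 0 < θ)
    (hgood : ∀ τ ∈ Ioo t₁ tstar, ∀ y : EuclideanSpace ℝ (Fin 3),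
      ‖y‖ < R + M * Real.sqrt (-τ) → ‖v τ y‖ ≤ a + η * (-τ) ^ (-(1 / 2 : ℝ)))
    {x : EuclideanSpace ℝ (Fin 3)} (hx : ‖x‖ < R + M * Real.sqrt (-t)) :
    ‖oseenDuhamel 1 t₁ v v t x‖ ≤
      4 * (C₀ * ∫ w : EuclideanSpace ℝ (Fin 3), (1 + ‖w‖ ^ 2) ^ (-(2 : ℝ))) * a ^ 2 *
          Real.sqrt (t - t₁) +
        2 * (C₀ * ∫ w : EuclideanSpace ℝ (Fin 3), (1 + ‖w‖ ^ 2) ^ (-(2 : ℝ))) * (C ^ 2 / (-t)) *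
          Real.sqrt (t - tstar) +
        (8 * (C₀ * ∫ w : EuclideanSpace ℝ (Fin 3), (1 + ‖w‖ ^ 2) ^ (-(2 : ℝ))) * η ^ 2 +
          2 * (C₀ * ∫ w : EuclideanSpace ℝ (Fin 3), (1 + ‖w‖ ^ 2) ^ (-(2 : ℝ))) * C ^ 2 *
            Real.sqrt θ +
          8 * (C₀ * (3 * (volume : Measure (EuclideanSpace ℝ (Fin 3))).real (ball 0 1))) * C ^ 2 *
            θ ^ (-(1 / 4 : ℝ)) / M) * (-t) ^ (-(1 / 2 : ℝ)) := by
  -- ## constants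
  set I₂ : ℝ := ∫ w : EuclideanSpace ℝ (Fin 3), (1 + ‖w‖ ^ 2) ^ (-(2 : ℝ)) with hI₂
  set V₃ : ℝ := 3 * (volume : Measure (EuclideanSpace ℝ (Fin 3))).real (ball 0 1) with hV₃
  set κ₁ : ℝ := C₀ * I₂ with hκ₁
  set κ₂ : ℝ := C₀ * V₃ with hκ₂
  have hI₂pos : 0 < I₂ := integral_one_add_norm_sq_rpow_neg_pos (E := EuclideanSpace ℝ (Fin 3))
    (by rw [finrank_euclideanSpace_fin]; norm_num)
  have hκ₁0 : 0 ≤ κ₁ := by positivity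
  have hκ₂0 : 0 ≤ κ₂ := by positivity
  have hC : 0 ≤ C := hv.nonneg
  have ht1t : t₁ < t := h1s.trans_le hst
  have hnt : 0 < -t := neg_pos.2 ht
  -- ## Step 1: the envelope majorant
  have hmaj := enorm_oseenDuhamel_le_lintegral hC₀.le hK t₁ t v x
  -- shorthand for the space integrand at time `τ`
  set w : ℝ → EuclideanSpace ℝ (Fin 3) → ℝ≥0∞ := fun τ y =>
    ENNReal.ofReal (C₀ * ((t - τ) + ‖x - y‖ ^ 2) ^ (-(2 : ℝ))) * ‖v τ y‖ₑ ^ 2 with hw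
  -- ## Step 2: the four majorants
  set Ggood : ℝ → ℝ≥0∞ := fun τ =>
    ENNReal.ofReal ((2 * a ^ 2) * (κ₁ * (t - τ) ^ (-(1 / 2 : ℝ)))) +
      ENNReal.ofReal ((2 * η ^ 2 * κ₁) * ((t - τ) ^ (-(1 / 2 : ℝ)) * (-τ)⁻¹)) with hGgood
  set Gcrude : ℝ → ℝ≥0∞ := fun τ =>
    ENNReal.ofReal ((κ₁ * (C ^ 2 / (-t))) * (t - τ) ^ (-(1 / 2 : ℝ))) with hGcrude
  set Gold : ℝ → ℝ≥0∞ := fun τ =>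
    ENNReal.ofReal ((2 * κ₂ * C ^ 2 / M) * ((-τ) ^ (-(1 / 2 : ℝ)) * (t - τ)⁻¹)) with hGold
  -- kernel integrals at a fixed time
  have henv : ∀ τ, τ < t → ∫⁻ y, ENNReal.ofReal (C₀ * ((t - τ) + ‖x - y‖ ^ 2) ^ (-(2 : ℝ))) =
      ENNReal.ofReal (κ₁ * (t - τ) ^ (-(1 / 2 : ℝ))) := by
    intro τ hτ
    have hσ : 0 < t - τ := sub_pos.2 hτ
    have e : ∀ y, ENNReal.ofReal (C₀ * ((t - τ) + ‖x - y‖ ^ 2) ^ (-(2 : ℝ))) =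
        ENNReal.ofReal C₀ * ENNReal.ofReal (((t - τ) + ‖x - y‖ ^ 2) ^ (-(2 : ℝ))) := fun y =>
      ENNReal.ofReal_mul hC₀.le
    simp_rw [e]
    rw [lintegral_const_mul' _ _ ENNReal.ofReal_ne_top, lintegral_env_eq hσ x,
      ← ENNReal.ofReal_mul hC₀.le]
    congr 1
    rw [hκ₁]; ring
  have henv_out : ∀ τ, τ < t → ∀ s, 0 < s →
      ∫⁻ y in (ball x s)ᶜ, ENNReal.ofReal (C₀ * ((t - τ) + ‖x - y‖ ^ 2) ^ (-(2 : ℝ))) ≤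
        ENNReal.ofReal (κ₂ * s⁻¹) := by
    intro τ hτ s hs
    have hσ : 0 < t - τ := sub_pos.2 hτ
    have e : ∀ y, ENNReal.ofReal (C₀ * ((t - τ) + ‖x - y‖ ^ 2) ^ (-(2 : ℝ))) =
        ENNReal.ofReal C₀ * ENNReal.ofReal (((t - τ) + ‖x - y‖ ^ 2) ^ (-(2 : ℝ))) := fun y =>
      ENNReal.ofReal_mul hC₀.le
    simp_rw [e]
    rw [lintegral_const_mul' _ _ ENNReal.ofReal_ne_top]
    calc ENNReal.ofReal C₀ * ∫⁻ y in (ball x s)ᶜ, ENNReal.ofReal (((t - τ) + ‖x - y‖ ^ 2) ^ (-(2 : ℝ)))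
        ≤ ENNReal.ofReal C₀ * ENNReal.ofReal (V₃ * s⁻¹) := by
          gcongr
          exact lintegral_env_compl_ball_le hσ hs x
      _ = ENNReal.ofReal (κ₂ * s⁻¹) := by
          rw [← ENNReal.ofReal_mul hC₀.le, hκ₂]; ring_nf
  -- Type-I bound in `ℝ≥0∞` squared form
  have htypeI : ∀ τ, τ < 0 → ∀ y, ‖v τ y‖ₑ ^ 2 ≤ ENNReal.ofReal (C ^ 2 * (-τ)⁻¹) := by
    intro τ hτ y
    have h := hv.norm_le hτ y
    have hτ0 : 0 < -τ := neg_pos.2 hτ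
    rw [← ofReal_norm, ← ENNReal.ofReal_pow (norm_nonneg _)]
    refine ENNReal.ofReal_le_ofReal ?_
    have hsq : Real.sqrt (-τ) ^ 2 = -τ := Real.sq_sqrt hτ0.le
    calc ‖v τ y‖ ^ 2 ≤ (C / Real.sqrt (-τ)) ^ 2 := pow_le_pow_left₀ (norm_nonneg _) h 2
      _ = C ^ 2 * (-τ)⁻¹ := by rw [div_pow, hsq, div_eq_mul_inv]
  -- ## Step 3: pointwise bound of the space integral at each time
  have hslice : ∀ τ ∈ Ioo t₁ t, ∫⁻ y, w τ y ≤
      (Iio tstar).indicator Ggood τ + (Ici tstar).indicator Gcrude τ +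
        ((Iic ((1 + θ) * t)).indicator Gold τ + (Ioi ((1 + θ) * t)).indicator Gcrude τ) := by
    intro τ hτ
    have hτt : τ < t := hτ.2
    have hτ0 : τ < 0 := hτt.trans ht
    have hnτ : 0 < -τ := neg_pos.2 hτ0
    have hσ : 0 < t - τ := sub_pos.2 hτt
    set S : Set (EuclideanSpace ℝ (Fin 3)) := ball 0 (R + M * Real.sqrt (-τ)) with hS
    rw [← lintegral_add_compl (μ := volume) (w τ) (measurableSet_ball : MeasurableSet S)]
    refine add_le_add ?_ ?_
    · -- ### inner part
      by_cases hgt : τ < tstar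
      · -- good time: `‖v‖² ≤ 2a² + 2η²/(−τ)` on `S`
        rw [indicator_of_mem (mem_Iio.2 hgt), indicator_of_notMem (fun h => not_le.2 hgt (mem_Ici.1 h)),
          add_zero]
        have hbd : ∀ y ∈ S, ‖v τ y‖ₑ ^ 2 ≤ ENNReal.ofReal (2 * a ^ 2 + 2 * η ^ 2 * (-τ)⁻¹) := by
          intro y hy
          have hyS : ‖y‖ < R + M * Real.sqrt (-τ) := by rwa [hS, mem_ball_zero_iff] at hy
          have h := hgood τ ⟨hτ.1, hgt⟩ y hyS
          rw [← ofReal_norm, ← ENNReal.ofReal_pow (norm_nonneg _)]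
          refine ENNReal.ofReal_le_ofReal ?_
          have hpow : (-τ) ^ (-(1 / 2 : ℝ)) * (-τ) ^ (-(1 / 2 : ℝ)) = (-τ)⁻¹ := by
            rw [← Real.rpow_add hnτ, ← Real.rpow_neg_one]; norm_num
          have hηp : 0 ≤ η * (-τ) ^ (-(1 / 2 : ℝ)) := mul_nonneg hη (Real.rpow_nonneg hnτ.le _)
          calc ‖v τ y‖ ^ 2 ≤ (a + η * (-τ) ^ (-(1 / 2 : ℝ))) ^ 2 := pow_le_pow_left₀ (norm_nonneg _) h 2
            _ ≤ 2 * a ^ 2 + 2 * (η * (-τ) ^ (-(1 / 2 : ℝ))) ^ 2 := by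
                  nlinarith [sq_nonneg (a - η * (-τ) ^ (-(1 / 2 : ℝ)))]
            _ = 2 * a ^ 2 + 2 * η ^ 2 * (-τ)⁻¹ := by rw [mul_pow, ← hpow]; ring
        calc ∫⁻ y in S, w τ y
            ≤ ∫⁻ y in S, ENNReal.ofReal (C₀ * ((t - τ) + ‖x - y‖ ^ 2) ^ (-(2 : ℝ))) *
                ENNReal.ofReal (2 * a ^ 2 + 2 * η ^ 2 * (-τ)⁻¹) :=
              setLIntegral_mono' measurableSet_ball fun y hy => mul_le_mul' le_rfl (hbd y hy)
          _ ≤ ∫⁻ y, ENNReal.ofReal (C₀ * ((t - τ) + ‖x - y‖ ^ 2) ^ (-(2 : ℝ))) *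
                ENNReal.ofReal (2 * a ^ 2 + 2 * η ^ 2 * (-τ)⁻¹) :=
              lintegral_mono' Measure.restrict_le_self le_rfl
          _ = ENNReal.ofReal (κ₁ * (t - τ) ^ (-(1 / 2 : ℝ))) *
                ENNReal.ofReal (2 * a ^ 2 + 2 * η ^ 2 * (-τ)⁻¹) := by
              rw [lintegral_mul_const' _ _ ENNReal.ofReal_ne_top, henv τ hτt]
          _ = Ggood τ := by
              simp only [hGgood]
              rw [← ENNReal.ofReal_mul (by positivity), ← ENNReal.ofReal_add (by positivity)
                (by positivity)]
              exact congrArg ENNReal.ofReal (by ring)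
      · -- crude time: `‖v‖² ≤ C²/(−t)`
        have hge : tstar ≤ τ := not_lt.1 hgt
        rw [indicator_of_notMem (fun h => hgt (mem_Iio.1 h)), indicator_of_mem (mem_Ici.2 hge),
          zero_add]
        have hbd : ∀ y, ‖v τ y‖ₑ ^ 2 ≤ ENNReal.ofReal (C ^ 2 / (-t)) := by
          intro y
          refine (htypeI τ hτ0 y).trans (ENNReal.ofReal_le_ofReal ?_)
          rw [div_eq_mul_inv]
          exact mul_le_mul_of_nonneg_left (inv_anti₀ hnt (by linarith)) (sq_nonneg _)
        calc ∫⁻ y in S, w τ y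
            ≤ ∫⁻ y in S, ENNReal.ofReal (C₀ * ((t - τ) + ‖x - y‖ ^ 2) ^ (-(2 : ℝ))) *
                ENNReal.ofReal (C ^ 2 / (-t)) :=
              setLIntegral_mono' measurableSet_ball fun y _ => mul_le_mul' le_rfl (hbd y)
          _ ≤ ∫⁻ y, ENNReal.ofReal (C₀ * ((t - τ) + ‖x - y‖ ^ 2) ^ (-(2 : ℝ))) *
                ENNReal.ofReal (C ^ 2 / (-t)) :=
              lintegral_mono' Measure.restrict_le_self le_rfl
          _ = ENNReal.ofReal (κ₁ * (t - τ) ^ (-(1 / 2 : ℝ))) * ENNReal.ofReal (C ^ 2 / (-t)) := by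
              rw [lintegral_mul_const' _ _ ENNReal.ofReal_ne_top, henv τ hτt]
          _ = Gcrude τ := by
              simp only [hGcrude]
              refine (ENNReal.ofReal_mul (by positivity)).symm.trans (congrArg ENNReal.ofReal ?_)
              ring
    · -- ### outer part: Type-I bound everywhere
      have hbd : ∀ y, ‖v τ y‖ₑ ^ 2 ≤ ENNReal.ofReal (C ^ 2 * (-τ)⁻¹) := fun y => htypeI τ hτ0 y
      have hout : ∫⁻ y in Sᶜ, w τ y ≤
          (∫⁻ y in Sᶜ, ENNReal.ofReal (C₀ * ((t - τ) + ‖x - y‖ ^ 2) ^ (-(2 : ℝ)))) *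
            ENNReal.ofReal (C ^ 2 * (-τ)⁻¹) := by
        rw [← lintegral_mul_const' _ _ ENNReal.ofReal_ne_top]
        exact setLIntegral_mono' measurableSet_ball.compl fun y _ => mul_le_mul' le_rfl (hbd y)
      refine hout.trans ?_
      by_cases hold : τ ≤ (1 + θ) * t
      · -- old time: parabolic separation and the kernel tail
        rw [indicator_of_mem (mem_Iic.2 hold), indicator_of_notMem
          (fun h => not_lt.2 hold (mem_Ioi.1 h)), add_zero]
        set s : ℝ := M * (t - τ) / (2 * Real.sqrt (-τ)) with hs
        have hsτ : 0 < Real.sqrt (-τ) := Real.sqrt_pos.2 hnτ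
        have hs0 : 0 < s := by rw [hs]; positivity
        have hsub : Sᶜ ⊆ (ball x s)ᶜ := by
          intro y hy
          have hy' : R + M * Real.sqrt (-τ) ≤ ‖y‖ := by
            rw [hS, mem_compl_iff, mem_ball_zero_iff, not_lt] at hy; exact hy
          exact parabolic_separation hM hτt ht hx hy'
        calc (∫⁻ y in Sᶜ, ENNReal.ofReal (C₀ * ((t - τ) + ‖x - y‖ ^ 2) ^ (-(2 : ℝ)))) *
              ENNReal.ofReal (C ^ 2 * (-τ)⁻¹)
            ≤ (∫⁻ y in (ball x s)ᶜ, ENNReal.ofReal (C₀ * ((t - τ) + ‖x - y‖ ^ 2) ^ (-(2 : ℝ)))) *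
                ENNReal.ofReal (C ^ 2 * (-τ)⁻¹) :=
              mul_le_mul' (lintegral_mono_set hsub) le_rfl
          _ ≤ ENNReal.ofReal (κ₂ * s⁻¹) * ENNReal.ofReal (C ^ 2 * (-τ)⁻¹) :=
              mul_le_mul' (henv_out τ hτt s hs0) le_rfl
          _ = Gold τ := by
              simp only [hGold]
              refine (ENNReal.ofReal_mul (by positivity)).symm.trans (congrArg ENNReal.ofReal ?_)
              rw [hs]
              have hsq : Real.sqrt (-τ) = (-τ) ^ (1 / 2 : ℝ) := Real.sqrt_eq_rpow _
              have hhalf : (-τ) ^ (-(1 / 2 : ℝ)) = (-τ) ^ (1 / 2 : ℝ) * (-τ)⁻¹ := by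
                rw [← Real.rpow_neg_one, ← Real.rpow_add hnτ]; norm_num
              rw [hhalf, hsq]
              have hτpow : 0 < (-τ) ^ (1 / 2 : ℝ) := Real.rpow_pos_of_pos hnτ _
              field_simp
      · -- recent time: no separation, kernel mass `κ₁ (t−τ)^{−1/2}`, and `(−τ)⁻¹ ≤ (−t)⁻¹`
        have hrec : (1 + θ) * t < τ := not_le.1 hold
        rw [indicator_of_notMem (fun h => hold (mem_Iic.1 h)), indicator_of_mem (mem_Ioi.2 hrec),
          zero_add]
        calc (∫⁻ y in Sᶜ, ENNReal.ofReal (C₀ * ((t - τ) + ‖x - y‖ ^ 2) ^ (-(2 : ℝ)))) *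
              ENNReal.ofReal (C ^ 2 * (-τ)⁻¹)
            ≤ (∫⁻ y, ENNReal.ofReal (C₀ * ((t - τ) + ‖x - y‖ ^ 2) ^ (-(2 : ℝ)))) *
                ENNReal.ofReal (C ^ 2 * (-t)⁻¹) :=
              mul_le_mul' (lintegral_mono' Measure.restrict_le_self le_rfl)
                (ENNReal.ofReal_le_ofReal (mul_le_mul_of_nonneg_left
                  (inv_anti₀ hnt (by linarith)) (sq_nonneg _)))
          _ = ENNReal.ofReal (κ₁ * (t - τ) ^ (-(1 / 2 : ℝ))) * ENNReal.ofReal (C ^ 2 * (-t)⁻¹) := by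
              rw [henv τ hτt]
          _ = Gcrude τ := by
              simp only [hGcrude]
              refine (ENNReal.ofReal_mul (by positivity)).symm.trans (congrArg ENNReal.ofReal ?_)
              rw [div_eq_mul_inv]; ring
  -- ## Step 4: the four time integrals
  have hIgood : ∫⁻ τ in Ioo t₁ t, (Iio tstar).indicator Ggood τ ≤
      ENNReal.ofReal (4 * κ₁ * a ^ 2 * Real.sqrt (t - t₁) + 8 * κ₁ * η ^ 2 * (-t) ^ (-(1 / 2 : ℝ))) := by
    have hm1 : Measurable fun τ : ℝ =>
        ENNReal.ofReal ((2 * a ^ 2) * (κ₁ * (t - τ) ^ (-(1 / 2 : ℝ)))) := by fun_prop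
    calc ∫⁻ τ in Ioo t₁ t, (Iio tstar).indicator Ggood τ
        ≤ ∫⁻ τ in Ioo t₁ t, Ggood τ := lintegral_mono fun τ => indicator_le_self _ _ τ
      _ = (∫⁻ τ in Ioo t₁ t, ENNReal.ofReal ((2 * a ^ 2) * (κ₁ * (t - τ) ^ (-(1 / 2 : ℝ))))) +
            ∫⁻ τ in Ioo t₁ t, ENNReal.ofReal ((2 * η ^ 2 * κ₁) * ((t - τ) ^ (-(1 / 2 : ℝ)) * (-τ)⁻¹)) := by
          simp only [hGgood]
          exact lintegral_add_left hm1 _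
      _ = (ENNReal.ofReal (2 * a ^ 2 * κ₁) * ∫⁻ τ in Ioo t₁ t, ENNReal.ofReal ((t - τ) ^ (-(1 / 2 : ℝ)))) +
            ENNReal.ofReal (2 * η ^ 2 * κ₁) *
              ∫⁻ τ in Ioo t₁ t, ENNReal.ofReal ((t - τ) ^ (-(1 / 2 : ℝ)) * (-τ)⁻¹) := by
          have e1 : (∫⁻ τ in Ioo t₁ t, ENNReal.ofReal ((2 * a ^ 2) * (κ₁ * (t - τ) ^ (-(1 / 2 : ℝ))))) =
              ENNReal.ofReal (2 * a ^ 2 * κ₁) *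
                ∫⁻ τ in Ioo t₁ t, ENNReal.ofReal ((t - τ) ^ (-(1 / 2 : ℝ))) := by
            rw [← lintegral_const_mul' _ _ ENNReal.ofReal_ne_top]
            refine lintegral_congr fun τ => ?_
            rw [← ENNReal.ofReal_mul (by positivity)]
            exact congrArg ENNReal.ofReal (by ring)
          have e2 : (∫⁻ τ in Ioo t₁ t, ENNReal.ofReal ((2 * η ^ 2 * κ₁) * ((t - τ) ^ (-(1 / 2 : ℝ)) * (-τ)⁻¹))) =
              ENNReal.ofReal (2 * η ^ 2 * κ₁) *
                ∫⁻ τ in Ioo t₁ t, ENNReal.ofReal ((t - τ) ^ (-(1 / 2 : ℝ)) * (-τ)⁻¹) := by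
            rw [← lintegral_const_mul' _ _ ENNReal.ofReal_ne_top]
            refine lintegral_congr fun τ => ?_
            rw [← ENNReal.ofReal_mul (by positivity)]
          rw [e1, e2]
      _ ≤ ENNReal.ofReal (2 * a ^ 2 * κ₁) * ENNReal.ofReal (2 * Real.sqrt (t - t₁)) +
            ENNReal.ofReal (2 * η ^ 2 * κ₁) * ENNReal.ofReal (4 * (-t) ^ (-(1 / 2 : ℝ))) := by
          gcongr
          · exact (setLIntegral_Ioo_sub_rpow_neg_half_of_lt ht1t).le
          · exact lintegral_Ioo_sub_rpow_half_mul_neg_inv_le t₁ ht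
      _ = ENNReal.ofReal (4 * κ₁ * a ^ 2 * Real.sqrt (t - t₁) + 8 * κ₁ * η ^ 2 * (-t) ^ (-(1 / 2 : ℝ))) := by
          rw [← ENNReal.ofReal_mul (by positivity), ← ENNReal.ofReal_mul (by positivity),
            ← ENNReal.ofReal_add (by positivity) (by positivity)]
          exact congrArg ENNReal.ofReal (by ring)
  have hIcrude : ∫⁻ τ in Ioo t₁ t, (Ici tstar).indicator Gcrude τ ≤
      ENNReal.ofReal (2 * κ₁ * (C ^ 2 / (-t)) * Real.sqrt (t - tstar)) := by
    have hset : ∫⁻ τ in Ioo t₁ t, (Ici tstar).indicator Gcrude τ = ∫⁻ τ in Ioo tstar t, Gcrude τ := by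
      rw [lintegral_indicator measurableSet_Ici, Measure.restrict_restrict measurableSet_Ici]
      have e : Ici tstar ∩ Ioo t₁ t = Ico tstar t := by
        ext τ; simp only [mem_inter_iff, mem_Ici, mem_Ioo, mem_Ico]
        constructor
        · rintro ⟨h1, -, h3⟩; exact ⟨h1, h3⟩
        · rintro ⟨h1, h3⟩; exact ⟨h1, h1s.trans_le h1, h3⟩
      rw [e, setLIntegral_congr (Ioo_ae_eq_Ico (μ := (volume : Measure ℝ))).symm]
    rw [hset]
    rcases eq_or_lt_of_le hst with heq | hlt
    · rw [heq, Ioo_self, Measure.restrict_empty, lintegral_zero_measure]; exact bot_le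
    simp only [hGcrude]
    have e : ∀ τ, ENNReal.ofReal ((κ₁ * (C ^ 2 / (-t))) * (t - τ) ^ (-(1 / 2 : ℝ))) =
        ENNReal.ofReal (κ₁ * (C ^ 2 / (-t))) * ENNReal.ofReal ((t - τ) ^ (-(1 / 2 : ℝ))) := fun τ =>
      ENNReal.ofReal_mul (by positivity)
    simp_rw [e]
    rw [lintegral_const_mul' _ _ ENNReal.ofReal_ne_top, setLIntegral_Ioo_sub_rpow_neg_half_of_lt hlt,
      ← ENNReal.ofReal_mul (by positivity)]
    refine ENNReal.ofReal_le_ofReal (le_of_eq ?_)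
    ring
  have hIold : ∫⁻ τ in Ioo t₁ t, (Iic ((1 + θ) * t)).indicator Gold τ ≤
      ENNReal.ofReal ((2 * κ₂ * C ^ 2 / M) * (4 * θ ^ (-(1 / 4 : ℝ)) * (-t) ^ (-(1 / 2 : ℝ)))) := by
    have hbt : (1 + θ) * t < t := by nlinarith
    have hset : ∫⁻ τ in Ioo t₁ t, (Iic ((1 + θ) * t)).indicator Gold τ ≤
        ∫⁻ τ in Ioo t₁ ((1 + θ) * t), Gold τ := by
      rw [lintegral_indicator measurableSet_Iic, Measure.restrict_restrict measurableSet_Iic]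
      rcases le_or_gt ((1 + θ) * t) t₁ with hle | hlt
      · have e : Iic ((1 + θ) * t) ∩ Ioo t₁ t = ∅ := by
          ext τ; simp only [mem_inter_iff, mem_Iic, mem_Ioo, mem_empty_iff_false, iff_false]
          rintro ⟨h1, h2, -⟩; linarith
        rw [e, Measure.restrict_empty, lintegral_zero_measure]; exact bot_le
      · have e : Iic ((1 + θ) * t) ∩ Ioo t₁ t = Ioc t₁ ((1 + θ) * t) := by
          ext τ; simp only [mem_inter_iff, mem_Iic, mem_Ioo, mem_Ioc]
          constructor
          · rintro ⟨h1, h2, -⟩; exact ⟨h2, h1⟩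
          · rintro ⟨h1, h2⟩; exact ⟨h2, h1, h2.trans_lt hbt⟩
        rw [e, setLIntegral_congr (Ioo_ae_eq_Ioc (μ := (volume : Measure ℝ))).symm]
    refine hset.trans ?_
    simp only [hGold]
    have e : ∀ τ, ENNReal.ofReal ((2 * κ₂ * C ^ 2 / M) * ((-τ) ^ (-(1 / 2 : ℝ)) * (t - τ)⁻¹)) =
        ENNReal.ofReal (2 * κ₂ * C ^ 2 / M) * ENNReal.ofReal ((-τ) ^ (-(1 / 2 : ℝ)) * (t - τ)⁻¹) :=
      fun τ => ENNReal.ofReal_mul (by positivity)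
    simp_rw [e]
    rw [lintegral_const_mul' _ _ ENNReal.ofReal_ne_top, ENNReal.ofReal_mul (by positivity)]
    gcongr
    exact lintegral_Ioo_old_exterior_le t₁ hθ ht
  have hIrecent : ∫⁻ τ in Ioo t₁ t, (Ioi ((1 + θ) * t)).indicator Gcrude τ ≤
      ENNReal.ofReal ((κ₁ * (C ^ 2 / (-t))) * (2 * Real.sqrt (θ * (-t)))) := by
    have hbt : (1 + θ) * t < t := by nlinarith
    have hset : ∫⁻ τ in Ioo t₁ t, (Ioi ((1 + θ) * t)).indicator Gcrude τ ≤
        ∫⁻ τ in Ioo ((1 + θ) * t) t, Gcrude τ := by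
      rw [lintegral_indicator measurableSet_Ioi, Measure.restrict_restrict measurableSet_Ioi]
      refine lintegral_mono_set ?_
      rintro τ ⟨h1, -, h3⟩; exact ⟨h1, h3⟩
    refine hset.trans ?_
    simp only [hGcrude]
    have e : ∀ τ, ENNReal.ofReal ((κ₁ * (C ^ 2 / (-t))) * (t - τ) ^ (-(1 / 2 : ℝ))) =
        ENNReal.ofReal (κ₁ * (C ^ 2 / (-t))) * ENNReal.ofReal ((t - τ) ^ (-(1 / 2 : ℝ))) := fun τ =>
      ENNReal.ofReal_mul (by positivity)
    simp_rw [e]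
    rw [lintegral_const_mul' _ _ ENNReal.ofReal_ne_top, lintegral_Ioo_recent_eq hθ ht,
      ← ENNReal.ofReal_mul (by positivity)]
  -- ## Step 5: assemble
  have hsum : ‖oseenDuhamel 1 t₁ v v t x‖ₑ ≤
      ENNReal.ofReal (4 * κ₁ * a ^ 2 * Real.sqrt (t - t₁) + 8 * κ₁ * η ^ 2 * (-t) ^ (-(1 / 2 : ℝ))) +
        ENNReal.ofReal (2 * κ₁ * (C ^ 2 / (-t)) * Real.sqrt (t - tstar)) +
        (ENNReal.ofReal ((2 * κ₂ * C ^ 2 / M) * (4 * θ ^ (-(1 / 4 : ℝ)) * (-t) ^ (-(1 / 2 : ℝ)))) +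
          ENNReal.ofReal ((κ₁ * (C ^ 2 / (-t))) * (2 * Real.sqrt (θ * (-t))))) := by
    refine hmaj.trans ?_
    have hmg : Measurable fun τ => (Iio tstar).indicator Ggood τ := by
      refine Measurable.indicator ?_ measurableSet_Iio
      simp only [hGgood]; fun_prop
    have hmc : Measurable fun τ => (Ici tstar).indicator Gcrude τ := by
      refine Measurable.indicator ?_ measurableSet_Ici
      simp only [hGcrude]; fun_prop
    have hmo : Measurable fun τ => (Iic ((1 + θ) * t)).indicator Gold τ := by
      refine Measurable.indicator ?_ measurableSet_Iic
      simp only [hGold]; fun_prop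
    calc ∫⁻ τ in Ioo t₁ t, ∫⁻ y, w τ y
        ≤ ∫⁻ τ in Ioo t₁ t, ((Iio tstar).indicator Ggood τ + (Ici tstar).indicator Gcrude τ +
            ((Iic ((1 + θ) * t)).indicator Gold τ + (Ioi ((1 + θ) * t)).indicator Gcrude τ)) :=
          setLIntegral_mono' measurableSet_Ioo hslice
      _ = (∫⁻ τ in Ioo t₁ t, (Iio tstar).indicator Ggood τ) +
            (∫⁻ τ in Ioo t₁ t, (Ici tstar).indicator Gcrude τ) +
            ((∫⁻ τ in Ioo t₁ t, (Iic ((1 + θ) * t)).indicator Gold τ) +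
              ∫⁻ τ in Ioo t₁ t, (Ioi ((1 + θ) * t)).indicator Gcrude τ) := by
          have hmgc : Measurable fun τ =>
              (Iio tstar).indicator Ggood τ + (Ici tstar).indicator Gcrude τ := hmg.add hmc
          rw [lintegral_add_left hmgc, lintegral_add_left hmg, lintegral_add_left hmo]
      _ ≤ _ := add_le_add (add_le_add hIgood hIcrude) (add_le_add hIold hIrecent)
  -- convert to a real inequality
  have hX1 : 0 ≤ 4 * κ₁ * a ^ 2 * Real.sqrt (t - t₁) + 8 * κ₁ * η ^ 2 * (-t) ^ (-(1 / 2 : ℝ)) := by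
    positivity
  have hX2 : 0 ≤ 2 * κ₁ * (C ^ 2 / (-t)) * Real.sqrt (t - tstar) := by positivity
  have hX3 : 0 ≤ (2 * κ₂ * C ^ 2 / M) * (4 * θ ^ (-(1 / 4 : ℝ)) * (-t) ^ (-(1 / 2 : ℝ))) := by positivity
  have hX4 : 0 ≤ (κ₁ * (C ^ 2 / (-t))) * (2 * Real.sqrt (θ * (-t))) := by positivity
  rw [← ENNReal.ofReal_add hX1 hX2, ← ENNReal.ofReal_add hX3 hX4,
    ← ENNReal.ofReal_add (add_nonneg hX1 hX2) (add_nonneg hX3 hX4), ← ofReal_norm,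
    ENNReal.ofReal_le_ofReal_iff (add_nonneg (add_nonneg hX1 hX2) (add_nonneg hX3 hX4))] at hsum
  refine hsum.trans (le_of_eq ?_)
  -- the recent term: `(C²/(−t)) · 2√(θ(−t)) = 2 C² √θ (−t)^{−1/2}`
  have hsqrt : Real.sqrt (θ * (-t)) = Real.sqrt θ * Real.sqrt (-t) := Real.sqrt_mul hθ.le _
  have hst' : Real.sqrt (-t) = (-t) ^ (1 / 2 : ℝ) := Real.sqrt_eq_rpow _
  have hrel : (-t)⁻¹ * (-t) ^ (1 / 2 : ℝ) = (-t) ^ (-(1 / 2 : ℝ)) := by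
    rw [← Real.rpow_neg_one, ← Real.rpow_add hnt]; norm_num
  rw [hsqrt, hst', div_eq_mul_inv (C ^ 2) (-t)]
  have e1 : κ₁ * (C ^ 2 * (-t)⁻¹) * (2 * (Real.sqrt θ * (-t) ^ (1 / 2 : ℝ))) =
      2 * κ₁ * C ^ 2 * Real.sqrt θ * ((-t)⁻¹ * (-t) ^ (1 / 2 : ℝ)) := by ring
  rw [e1, hrel, hκ₁, hκ₂]
  ring

end Summit.NavierStokesRegularity.NavierStokesRegularity.Theorems.RecurrentReductionD

end
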